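import Mathlib

/-!
# STRATEGY-CENSUS gen 3 — kernel-checked companion (crux `ThinBlockAlpha.ThinPackings`, stmt-MatrixMultiplication-10595)

Strategist planner-cstrat-stmt-MatrixMultiplication-10595-p3-0, 2026-08-17.  Typed objects of census §N15–N16:

* `BollobasSetPairs`, `SkewBollobasSetPairs` — the classical set-pair inequalities (Bollobás 1965; skew version
  Lovász 1977 / Frankl 1982 / Kalai 1984), page-checked in Jukna, *Extremal Combinatorics* (2011) Thm 9.7 / 9.8 / 9.10
  (held: `book:jukna2011-extremal-combinatorics-with-applications-computer-science`, chunks 106–108).  NOT in Mathlib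
  (only LYM/Sperner: `Finset.lubell_yamamoto_meshalkin_inequality_sum_card_div_choose`, `IsAntichain.sperner`); filed as a
  cite/fact request.  Stated here as named `Prop`s and used as hypotheses.
* `IsDisjointTriple`, `IsInducedMatching` — the partial-tripartition ("disjointness") hypergraph
  `D(N,n) = {(Z₁,Z₂,Z₃) : pairwise disjoint n-subsets of [N]}` and its induced matchings (= free diagonals = the zero-out
  extractions of the laser method; CFTZ arXiv:2111.08262 §3.2 "induced matching number").  This is EXACTLY the corner-free
  (`b = 0`) model of the gen-2 onion structure `S₇ ∖ corners = {011,101,110,111}`: levels `{0,1}`, supported iff the three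
  zero-sets are pairwise disjoint; `n = aN`; at `3n = N` it is the balanced TRIPARTITION hypergraph (USPs are its induced
  matchings, CKSU 2005 §3; Pratt / Björklund–Kaski's `T_k`).
* `inducedMatching_card_le` — PROVED (modulo the named classical fact): every induced matching of `D(N,n)` has at most
  `C(3n, n)` members, INDEPENDENTLY OF `N`.  Since `C(3n,n) = 2^{3n·h(1/3) + o(n)}` is attained up to `2^{-o(n)}` by the
  tripartitions of a fixed `3n`-set (Strassen/CW hashing on the tight sub-structure), the typed free-diagonal capacity of
  the non-Latin structure at zero-density `a < 1/3` is `3a·h(1/3)` bits per coordinate, NOT the marginal entropy `H₂(a)`: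
  the whole "mixing entropy" of the onion (census gen 2 §T11) is confiscated.  The same bound for COMBINATORIAL
  DEGENERATIONS (monomial degenerations, CFTZ Def. 3.x) follows from the SKEW inequality, because the partner digraph
  `δ → δ' :⇔ Z₁(δ') ∩ (Z₂(δ) ∪ Z₃(δ)) = ∅` must be acyclic under a degeneration (`u₁(Z₁(δ')) > u₁(Z₁(δ))` along arcs):
  `inducedMatching_card_le_of_acyclic` (PROVED modulo `SkewBollobasSetPairs`).
-/

set_option linter.dupNamespace false

namespace Summit.MatrixMultiplication.MatrixMultiplication.Cruxes.ThinPackings.CensusP3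

open Finset

/-- **Bollobás's set-pair inequality** (1965; Jukna 2011 Thm 9.7): if `A₁,…,A_m` are `a`-sets and `B₁,…,B_m` are
`b`-sets with `A_i ∩ B_i = ∅` and `A_i ∩ B_j ≠ ∅` for `i ≠ j`, then `m ≤ C(a+b, a)`.  Named classical fact (to be proved in
`Literature/Combinatorics/SetFamily/`; the permutation double count is ~40 lines). -/
def BollobasSetPairs : Prop :=
  ∀ (α : Type) [DecidableEq α] (m a b : ℕ) (A B : Fin m → Finset α),
    (∀ i, (A i).card = a) → (∀ i, (B i).card = b) → (∀ i, Disjoint (A i) (B i)) →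
    (∀ i j, i ≠ j → ¬ Disjoint (A i) (B j)) → m ≤ (a + b).choose a

/-- **Skew version** (Lovász 1977 / Frankl 1982 / Kalai 1984; Jukna 2011 Thm 9.10): the cross condition is only required
for `i < j`; same bound. -/
def SkewBollobasSetPairs : Prop :=
  ∀ (α : Type) [DecidableEq α] (m a b : ℕ) (A B : Fin m → Finset α),
    (∀ i, (A i).card = a) → (∀ i, (B i).card = b) → (∀ i, Disjoint (A i) (B i)) →
    (∀ i j, i < j → ¬ Disjoint (A i) (B j)) → m ≤ (a + b).choose a

/-- A triple of pairwise disjoint `n`-subsets of `Fin N` (an edge of the partial-tripartition hypergraph `D(N,n)`). -/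
def IsDisjointTriple (N n : ℕ) (δ : Finset (Fin N) × Finset (Fin N) × Finset (Fin N)) : Prop :=
  δ.1.card = n ∧ δ.2.1.card = n ∧ δ.2.2.card = n ∧
    Disjoint δ.1 δ.2.1 ∧ Disjoint δ.1 δ.2.2 ∧ Disjoint δ.2.1 δ.2.2

/-- An **induced matching** (free diagonal) of `D(N,n)`: a family of edges such that the only edge all of whose three
components are components of members (in the right positions) is a member with all three components from itself.
(Distinct members then have distinct first, second and third components.) -/
def IsInducedMatching (N n : ℕ) (Δ : Finset (Finset (Fin N) × Finset (Fin N) × Finset (Fin N))) : Prop :=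
  (∀ δ ∈ Δ, IsDisjointTriple N n δ) ∧
    ∀ δ ∈ Δ, ∀ δ' ∈ Δ, ∀ δ'' ∈ Δ,
      (Disjoint δ.1 δ'.2.1 ∧ Disjoint δ.1 δ''.2.2 ∧ Disjoint δ'.2.1 δ''.2.2) → δ = δ' ∧ δ' = δ''

/-- **The confiscation lemma (census gen 3 §N15), zero-out form.**  Every induced matching of `D(N,n)` has at most
`C(3n,n)` members — independently of `N`.  Proof: the set pairs `(Z₁(δ), Z₂(δ) ∪ Z₃(δ))` form a Bollobás system:
own pair disjoint, and for `δ ≠ δ'` the first component of `δ'` must meet `Z₂(δ) ∪ Z₃(δ)`, else `(Z₁(δ'), Z₂(δ), Z₃(δ))`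
is an edge with components from members, forcing `δ' = δ`. -/
theorem inducedMatching_card_le (hB : BollobasSetPairs) {N n : ℕ}
    (Δ : Finset (Finset (Fin N) × Finset (Fin N) × Finset (Fin N))) (hΔ : IsInducedMatching N n Δ) :
    Δ.card ≤ (3 * n).choose n := by
  classical
  obtain ⟨hedge, hfree⟩ := hΔ
  set m := Δ.card with hm
  let e : Fin m ≃ Δ := Δ.equivFin.symm
  let A : Fin m → Finset (Fin N) := fun i => (e i).1.1
  let B : Fin m → Finset (Fin N) := fun i => (e i).1.2.1 ∪ (e i).1.2.2
  have hA : ∀ i, (A i).card = n := fun i => (hedge _ (e i).2).1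
  have hBcard : ∀ i, (B i).card = 2 * n := by
    intro i
    obtain ⟨_, h2, h3, _, _, h23⟩ := hedge _ (e i).2
    show ((e i).1.2.1 ∪ (e i).1.2.2).card = 2 * n
    rw [Finset.card_union_of_disjoint h23, h2, h3]; ring
  have hown : ∀ i, Disjoint (A i) (B i) := by
    intro i
    obtain ⟨_, _, _, h12, h13, _⟩ := hedge _ (e i).2
    show Disjoint (e i).1.1 ((e i).1.2.1 ∪ (e i).1.2.2)
    exact Finset.disjoint_union_right.2 ⟨h12, h13⟩
  have hcross : ∀ i j, i ≠ j → ¬ Disjoint (A i) (B j) := by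
    intro i j hij hdis
    have hdis' : Disjoint (e i).1.1 ((e j).1.2.1 ∪ (e j).1.2.2) := hdis
    rw [Finset.disjoint_union_right] at hdis'
    obtain ⟨_, _, _, _, _, h23⟩ := hedge _ (e j).2
    have key := hfree _ (e i).2 _ (e j).2 _ (e j).2 ⟨hdis'.1, hdis'.2, h23⟩
    have : e i = e j := Subtype.ext key.1
    exact hij (e.injective this)
  have := hB (Fin N) m n (2 * n) A B hA hBcard hown hcross
  simpa [show n + 2 * n = 3 * n by ring] using this

/-- **Degeneration form (census §N16).**  If the members can be LINEARLY ORDERED so that "the first component of an EARLIER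
member is a valid partner of a LATER member's (second, third)" never happens — which is what a combinatorial degeneration
forces (weights `u₁ u₂ u₃` vanishing on the diagonal and positive on every other edge give `u₁(Z₁(δ')) > u₁(Z₁(δ))` whenever
`Z₁(δ')` is a valid partner of `δ`; order the members by increasing `u₁ ∘ Z₁`) — the same bound holds by the skew
inequality.  Stated for a family indexed in that order by `Fin m`. -/
theorem inducedMatching_card_le_of_acyclic (hS : SkewBollobasSetPairs) {N n m : ℕ}
    (Z₁ Z₂ Z₃ : Fin m → Finset (Fin N))
    (hcard : ∀ i, (Z₁ i).card = n ∧ (Z₂ i).card = n ∧ (Z₃ i).card = n)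
    (hdisj : ∀ i, Disjoint (Z₁ i) (Z₂ i) ∧ Disjoint (Z₁ i) (Z₃ i) ∧ Disjoint (Z₂ i) (Z₃ i))
    (hnoBackArc : ∀ i j, i < j → ¬ (Disjoint (Z₁ i) (Z₂ j) ∧ Disjoint (Z₁ i) (Z₃ j))) :
    m ≤ (3 * n).choose n := by
  classical
  let A : Fin m → Finset (Fin N) := fun i => Z₁ i
  let B : Fin m → Finset (Fin N) := fun i => Z₂ i ∪ Z₃ i
  have hA : ∀ i, (A i).card = n := fun i => (hcard i).1
  have hB : ∀ i, (B i).card = 2 * n := by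
    intro i
    show (Z₂ i ∪ Z₃ i).card = 2 * n
    rw [Finset.card_union_of_disjoint (hdisj i).2.2, (hcard i).2.1, (hcard i).2.2]; ring
  have hown : ∀ i, Disjoint (A i) (B i) := fun i =>
    Finset.disjoint_union_right.2 ⟨(hdisj i).1, (hdisj i).2.1⟩
  have hcross : ∀ i j, i < j → ¬ Disjoint (A i) (B j) := by
    intro i j hij hdis
    have hdis' : Disjoint (Z₁ i) (Z₂ j ∪ Z₃ j) := hdis
    rw [Finset.disjoint_union_right] at hdis'
    exact hnoBackArc i j hij hdis'
  have := hS (Fin N) m n (2 * n) A B hA hB hown hcross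
  simpa [show n + 2 * n = 3 * n by ring] using this

/-- Sanity anchor: `C(3n,n)` does not depend on the ground-set size `N`, whereas the number of candidate first components
`C(N,n)` does — e.g. `n = 1`: at most `3` members however large `N` (brute force in the census: `2` for `N = 4,5,6`). -/
example : (3 * 1).choose 1 = 3 ∧ (3 * 2).choose 2 = 15 := by decide

end Summit.MatrixMultiplication.MatrixMultiplication.Cruxes.ThinPackings.CensusP3
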